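import Literature.Topology.FourManifolds.TubularSplitting
import Literature.Topology.FourManifolds.RegularSublevelAmbient
import Literature.Topology.FourManifolds.BoundaryGluingData
import HarnessLib

/-!
# Tubes survive a regluing away from them

Topic `Literature/Topology/FourManifolds` (tube coordinates, `TubularSplitting.lean`; boundary
gluings, `BoundaryGluingData.lean`).  Written for the Seiberg–Witten leaf
`Literature.Barriers.SmoothPoincare4.akhmedovPark2010_lemma8_invariants` (A. Akhmedov, B. D. Park,
Invent. Math. 181 (2010) 577–603, Lemma 8): the normal connected sum
`X₁(m) = Y₁(1,1) #_ψ Z''(1,m)` of §9 there is taken along the genus-2 surfaces `Σ₂ ⊂ Y₁(1,1)`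
and `Σ̄₂ ⊂ Z''(1,m)`, which are the surfaces `Σ₂ × {pt} ⊂ Σ₂ × T²` and `Σ̄₂ ⊂ T⁴ # ℂℙ²bar`
viewed in the torus-surgered manifolds — "The surfaces `Σ₂ × {pt}` and `{pt} × Σₙ` in
`Σ₂ × Σₙ` descend to surfaces in `Yₙ(m)`" (§2), "Note that `Σ̄₂` is still a submanifold of
`Z''(1/q, m/r)`" (§4): the surgery tori are disjoint from these surfaces, so the surfaces WITH
THEIR TUBULAR NEIGHBOURHOODS sit unchanged in the surgered manifolds.  In the tube coordinates of
the tree (a tube is a topological embedding `T : F × ℝᶜ → Y` together with a *tube function*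
`g : Y → ℝ`, smooth, with regular level `¼`, `{g ∘ T ≤ ¼} = {‖v‖ ≤ ½}`, `{g ∘ T < ¼} = {‖v‖ < ½}`
and `g ≡ 1` off the tube; `exists_tube_function`) this is the following PROVED statement (no
definitions, no named facts):

* `exists_tube_transport` — let `T' : F' × ℝ^{c'} → Y` be a second tube with tube function
  `g'`, DISJOINT from `T`, and let `P` be any boundary gluing (`G : BoundaryGluingData`) of the
  complement `M = {¼ ≤ g'}` of `T'` with an arbitrary piece `N` (a surgery along `F'`;
  for `F' = T²`, `c' = 2` a torus surgery).  Then `T_P = jA ∘ T : F × ℝᶜ → P` is a tube in `P`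
  with tube function `g_P = g ∘ jA⁻¹` on `jA M`, `g_P = 1` on `jB N`: `T_P` is a topological
  embedding, `g_P` is smooth with regular level `¼` (criticality transfers along the
  equidimensional embedding `jA` at interior points, chain rule, and along `{¼ ≤ g'} ↪ Y`,
  `RegularSublevel.isMCriticalPt_comp_incl_iff`), the three tube identities hold, and
  `range T_P = jA (M ∩ range T)`.
* `disjoint_image_jA_preimage_incl` — transported disjoint tubes stay disjoint.

So every further surgery, and finally the fibre sum, can be performed in tube coordinates on
the surgered manifold (`SignatureCupTrivialPieces.lean`, `OrientableBoundaryGluing.lean`,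
`SmallExoticaFrontierReductionLemma8Proofs.lean` §§10–11).

## References

* A. Akhmedov, B. D. Park, *Exotic smooth structures on small 4-manifolds with odd signatures*,
  Invent. Math. 181 (2010) 577–603, §2 ("descend to surfaces in `Yₙ(m)`"), §4 ("`Σ̄₂` is still
  a submanifold of `Z''(1/q,m/r)`"), §9. [AkhmedovPark2010]
* R. E. Gompf, A. I. Stipsicz, *4-Manifolds and Kirby Calculus*, GSM 20, AMS 1999, §8.3
  (logarithmic transformations are local). [GompfStipsiczGSM1999]
* J. Milnor, *Morse theory*, Ann. of Math. Studies 51 (1963), §3, Thm. 3.1 (`Mᵃ`). [Milnor1963]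
-/

noncomputable section

open scoped Manifold ContDiff Topology
open Set Function Topology

namespace Literature.Topology.FourManifolds

section Transport

variable {k c c' : ℕ}
  {Y : Type} [TopologicalSpace Y] [CompactSpace Y]
  [ChartedSpace (EuclideanSpace ℝ (Fin (k + 1))) Y] [IsManifold (𝓡 (k + 1)) ∞ Y]
  {F : Type} [TopologicalSpace F] {T : F × EuclideanSpace ℝ (Fin c) → Y} {g : Y → ℝ}
  {F' : Type} {T' : F' × EuclideanSpace ℝ (Fin c') → Y} {g' : Y → ℝ}
  {N : Type} [TopologicalSpace N] [ChartedSpace (EuclideanHalfSpace (k + 1)) N]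
  {bN : BoundaryData (𝓡∂ (k + 1)) N (𝓡 k)}
  {P : Type} [TopologicalSpace P] [T2Space P] [ChartedSpace (EuclideanSpace ℝ (Fin (k + 1))) P]
  [IsManifold (𝓡 (k + 1)) ∞ P]

/-- **A tube survives a regluing away from it.**  Let `Y` be a compact smooth manifold,
`T : F × ℝᶜ → Y` a topological embedding with tube function `g` (`F` nonempty), `T'` a second
tube with tube function `g'` (regular level `¼`, `g' ≡ 1` off `T'`) disjoint from `T`, and let
`G : BoundaryGluingData` glue the complement `M = {¼ ≤ g'}` of `T'` to a piece `N` into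
the smooth manifold `P`.  Then there are a topological embedding `T_P : F × ℝᶜ → P` and a tube
function `g_P` for it — smooth with regular level `¼`, `{g_P ∘ T_P ≤ ¼} = {‖v‖ ≤ ½}`,
`{g_P ∘ T_P < ¼} = {‖v‖ < ½}`, `g_P ≡ 1` off `T_P` — with `T_P x = jA a` whenever `a ∈ M` lies
over `T x`, `g_P (jA a) = g a`, `g_P ≡ 1` on `jB N`, and `range T_P = jA (M ∩ range T)`
(Akhmedov–Park 2010, §2: the surfaces "descend to surfaces in `Yₙ(m)`"; §4: "`Σ̄₂` is still a
submanifold of `Z''(1/q, m/r)`"). [cite: AkhmedovPark2010, §2 and §4] [cite: Milnor1963, Thm. 3.1] -/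
theorem exists_tube_transport [Nonempty F] (hT : Topology.IsEmbedding T)
    (hreg : IsRegularLevel (𝓡 (k + 1)) g (1 / 4)) (hle : ∀ x, g (T x) ≤ 1 / 4 ↔ ‖x.2‖ ≤ 1 / 2)
    (hlt : ∀ x, g (T x) < 1 / 4 ↔ ‖x.2‖ < 1 / 2) (hout : ∀ y, y ∉ range T → g y = 1)
    (hreg' : IsRegularLevel (𝓡 (k + 1)) g' (1 / 4)) (hout' : ∀ y, y ∉ range T' → g' y = 1)
    (hdisj : Disjoint (range T) (range T'))
    {φ : (RegularSublevel.boundaryData hreg'.const_sub).carrier ≃ bN.carrier}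
    (G : BoundaryGluingData (RegularSublevel.boundaryData hreg'.const_sub) bN φ P) :
    ∃ (TP : F × EuclideanSpace ℝ (Fin c) → P) (gP : P → ℝ),
      Topology.IsEmbedding TP ∧ IsRegularLevel (𝓡 (k + 1)) gP (1 / 4) ∧
      (∀ x, gP (TP x) ≤ 1 / 4 ↔ ‖x.2‖ ≤ 1 / 2) ∧ (∀ x, gP (TP x) < 1 / 4 ↔ ‖x.2‖ < 1 / 2) ∧
      (∀ p, p ∉ range TP → gP p = 1) ∧
      (∀ (x) (a : RegularSuperlevel hreg'), RegularSublevel.incl hreg'.const_sub a = T x →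
        TP x = G.jA a) ∧
      (∀ a : RegularSuperlevel hreg', gP (G.jA a) = g (RegularSublevel.incl hreg'.const_sub a)) ∧
      (∀ b : N, gP (G.jB b) = 1) ∧
      range TP = G.jA '' (RegularSublevel.incl hreg'.const_sub ⁻¹' range T) := by
  classical
  -- notation: `M = {¼ ≤ g'}`, `ι : M → Y`
  set ι := RegularSublevel.incl hreg'.const_sub with hι
  -- `g' = 1` on the tube `T` (disjointness), so `T` lands in `M`
  have hg'T : ∀ x, g' (T x) = 1 := fun x =>
    hout' _ (fun h => hdisj.ne_of_mem (mem_range_self x) h rfl)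
  have hTM : ∀ x, (fun y => 1 / 4 - g' y) (T x) ≤ 0 := fun x => by
    show 1 / 4 - g' (T x) ≤ 0
    rw [hg'T]; norm_num
  -- on `M`, points with `g' < 1` carry `g = 1`
  have hg_one : ∀ a : RegularSuperlevel hreg', g' (ι a) < 1 → g (ι a) = 1 := by
    intro a ha
    apply hout
    intro hmem
    have h' : ι a ∈ range T' := by
      by_contra h
      exact absurd (hout' _ h) (ne_of_lt ha)
    exact hdisj.ne_of_mem hmem h' rfl
  haveI : Nonempty (RegularSuperlevel hreg') :=
    ⟨RegularSublevel.mk hreg'.const_sub (T (Classical.arbitrary _)) (hTM _)⟩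
  -- the transported tube and tube function
  let Tm : F × EuclideanSpace ℝ (Fin c) → RegularSuperlevel hreg' :=
    fun x => RegularSublevel.mk hreg'.const_sub (T x) (hTM x)
  let TP : F × EuclideanSpace ℝ (Fin c) → P := fun x => G.jA (Tm x)
  let gP : P → ℝ := fun p => if p ∈ range G.jA then g (ι (G.invA p)) else 1
  have hιTm : ∀ x, ι (Tm x) = T x := fun x => rfl
  have hjA : ∀ a, gP (G.jA a) = g (ι a) := fun a => by
    simp only [gP, if_pos (mem_range_self a), G.invA_jA]
  have hgPT : ∀ x, gP (TP x) = g (T x) := fun x => by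
    show gP (G.jA (Tm x)) = g (T x)
    rw [hjA, hιTm]
  -- boundary points of `M` lie on the level `g' = ¼`, hence carry `g = 1`
  have hbdry : ∀ a : RegularSuperlevel hreg', a ∈ (𝓡∂ (k + 1)).boundary (RegularSuperlevel hreg') →
      g (ι a) = 1 := by
    intro a ha
    have h := (RegularSublevel.mem_boundary_iff hreg'.const_sub a).1 ha
    apply hg_one
    change 1 / 4 - g' (ι a) = 0 at h
    linarith
  have hjB : ∀ b : N, gP (G.jB b) = 1 := by
    intro b
    by_cases hb : G.jB b ∈ range G.jA
    · obtain ⟨a, ha⟩ := hb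
      rw [← ha, hjA]
      apply hbdry
      have hs : G.jA a ∈ G.seam := by
        rw [← G.range_inter_range]; exact ⟨mem_range_self a, ha ▸ mem_range_self b⟩
      obtain ⟨z, hz⟩ := (G.jA_mem_seam_iff a).1 hs
      rw [← hz]
      exact z.2
    · simp only [gP, if_neg hb]
  -- `gP = 1` off `range jA`
  have hoff : ∀ p, p ∉ range G.jA → gP p = 1 := fun p hp => by simp only [gP, if_neg hp]
  -- the open set `O₂` on which `gP = 1`
  set K : Set (RegularSuperlevel hreg') := {a | 1 ≤ g' (ι a)} with hK
  have hKc : IsClosed K := isClosed_le continuous_const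
    (hreg'.contMDiff.continuous.comp (RegularSublevel.continuous_incl _))
  have hO₂ : IsOpen (G.jA '' K)ᶜ :=
    ((hKc.isCompact.image G.continuous_jA).isClosed).isOpen_compl
  have hgP_O₂ : ∀ p ∈ (G.jA '' K)ᶜ, gP p = 1 := by
    intro p hp
    by_cases hpA : p ∈ range G.jA
    · obtain ⟨a, rfl⟩ := hpA
      rw [hjA]
      apply hg_one
      by_contra h
      exact hp ⟨a, not_lt.1 h, rfl⟩
    · exact hoff p hpA
  -- the open set `O₁ = jA (int M)` on which `gP = g ∘ ι ∘ jA⁻¹`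
  have hO₁ : IsOpen (G.jA '' (𝓡∂ (k + 1)).interior (RegularSuperlevel hreg')) :=
    G.isOpen_image_jA_interior
  have hO₁sub : G.jA '' (𝓡∂ (k + 1)).interior (RegularSuperlevel hreg') ⊆ range G.jA :=
    image_subset_range _ _
  have hsmooth_on : ContMDiffOn (𝓡 (k + 1)) 𝓘(ℝ, ℝ) ∞ ((g ∘ ι) ∘ G.invA) (range G.jA) :=
    (hreg.contMDiff.comp (RegularSublevel.contMDiff_incl _)).comp_contMDiffOn G.contMDiffOn_invA
  have hgP_eqOn : EqOn gP ((g ∘ ι) ∘ G.invA) (range G.jA) := by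
    rintro p ⟨a, rfl⟩
    show gP (G.jA a) = g (ι (G.invA (G.jA a)))
    rw [hjA, G.invA_jA]
  have hcover : ∀ p : P, p ∈ (G.jA '' K)ᶜ ∨
      p ∈ G.jA '' (𝓡∂ (k + 1)).interior (RegularSuperlevel hreg') := by
    intro p
    by_cases hp : p ∈ (G.jA '' K)ᶜ
    · exact Or.inl hp
    · right
      simp only [mem_compl_iff, not_not] at hp
      obtain ⟨a, ha, rfl⟩ := hp
      refine ⟨a, ?_, rfl⟩
      rw [← ModelWithCorners.compl_boundary, mem_compl_iff,
        RegularSublevel.mem_boundary_iff hreg'.const_sub a]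
      change ¬ (1 / 4 - g' (ι a) = 0)
      intro h
      have : (1 : ℝ) ≤ g' (ι a) := ha
      linarith
  have hsmoothAt : ∀ p, ContMDiffAt (𝓡 (k + 1)) 𝓘(ℝ, ℝ) ∞ gP p := by
    intro p
    rcases hcover p with hp | hp
    · have hev : gP =ᶠ[𝓝 p] fun _ => (1 : ℝ) :=
        Filter.eventually_of_mem (hO₂.mem_nhds hp) hgP_O₂
      exact contMDiffAt_const.congr_of_eventuallyEq hev
    · have hnhds : range G.jA ∈ 𝓝 p := Filter.mem_of_superset (hO₁.mem_nhds hp) hO₁sub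
      have h1 : ContMDiffAt (𝓡 (k + 1)) 𝓘(ℝ, ℝ) ∞ ((g ∘ ι) ∘ G.invA) p :=
        (hsmooth_on p (hO₁sub hp)).contMDiffAt hnhds
      exact h1.congr_of_eventuallyEq (Filter.eventually_of_mem hnhds hgP_eqOn)
  have hsmooth : ContMDiff (𝓡 (k + 1)) 𝓘(ℝ, ℝ) ∞ gP := hsmoothAt
  -- regularity of the level `gP = ¼`
  have hregP : IsRegularLevel (𝓡 (k + 1)) gP (1 / 4) := by
    refine ⟨hsmooth, fun p _ => isInteriorPoint_euclidean (k := k) p, ?_⟩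
    intro p hp hcrit
    -- `p = jA a` with `a` interior and `g (ι a) = ¼`
    have hpA : p ∈ range G.jA := by
      by_contra h
      rw [hoff p h] at hp
      norm_num at hp
    obtain ⟨a, rfl⟩ := hpA
    rw [hjA] at hp
    have ha_int : ι a ∉ g' ⁻¹' {1 / 4} := by
      intro h
      simp only [mem_preimage, mem_singleton_iff] at h
      have := hg_one a (by rw [h]; norm_num)
      rw [this] at hp
      norm_num at hp
    -- chain rule along `jA`: `gP ∘ jA = g ∘ ι`
    have hcomp : gP ∘ G.jA = g ∘ ι := funext hjA
    have hdjA : MDifferentiableAt (𝓡∂ (k + 1)) (𝓡 (k + 1)) G.jA a :=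
      (G.contMDiff_jA a).mdifferentiableAt (by simp)
    have hdgP : MDifferentiableAt (𝓡 (k + 1)) 𝓘(ℝ, ℝ) gP (G.jA a) :=
      (hsmoothAt _).mdifferentiableAt (by simp)
    have hchain := mfderiv_comp a hdgP hdjA
    have hcritM : IsMCriticalPt (𝓡∂ (k + 1)) (g ∘ ι) a := by
      show mfderiv (𝓡∂ (k + 1)) 𝓘(ℝ, ℝ) (g ∘ ι) a = 0
      rw [← hcomp, hchain]
      rw [show mfderiv (𝓡 (k + 1)) 𝓘(ℝ, ℝ) gP (G.jA a) = 0 from hcrit]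
      rfl
    have hcritY : IsMCriticalPt (𝓡 (k + 1)) g (ι a) :=
      (RegularSublevel.isMCriticalPt_comp_incl_iff hreg'.const_sub hreg.contMDiff a).1 hcritM
    exact hreg.not_isMCriticalPt hp hcritY
  -- the embedding
  have hTm : Topology.IsEmbedding Tm := hT.codRestrict _ hTM
  have hTP : Topology.IsEmbedding TP := G.isSmoothEmbedding_jA.isEmbedding.comp hTm
  refine ⟨TP, gP, hTP, hregP, fun x => by rw [hgPT]; exact hle x,
    fun x => by rw [hgPT]; exact hlt x, ?_, ?_, hjA, hjB, ?_⟩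
  · -- `gP = 1` off the transported tube
    intro p hp
    by_cases hpA : p ∈ range G.jA
    · obtain ⟨a, rfl⟩ := hpA
      rw [hjA]
      apply hout
      rintro ⟨x, hx⟩
      apply hp
      refine ⟨x, ?_⟩
      show G.jA (Tm x) = G.jA a
      congr 1
      exact RegularSublevel.injective_incl _ (by show ι (Tm x) = ι a; rw [hιTm, hx])
    · exact hoff p hpA
  · -- the formula for `TP`
    intro x a ha
    show G.jA (Tm x) = G.jA a
    congr 1
    exact RegularSublevel.injective_incl _ (by show ι (Tm x) = ι a; rw [hιTm, ha])
  · -- the range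
    ext p
    constructor
    · rintro ⟨x, rfl⟩
      exact ⟨Tm x, ⟨x, (hιTm x).symm⟩, rfl⟩
    · rintro ⟨a, ⟨x, hx⟩, rfl⟩
      refine ⟨x, ?_⟩
      show G.jA (Tm x) = G.jA a
      congr 1
      exact RegularSublevel.injective_incl _ (by show ι (Tm x) = ι a; rw [hιTm, hx])

omit [CompactSpace Y] [T2Space P] [IsManifold (𝓡 (k + 1)) ∞ P] in
/-- **Transported disjoint tubes stay disjoint**: if two tubes `T₁`, `T₂` of `Y` have disjoint
ranges then so do their transports `jA (M ∩ range Tᵢ)` to a regluing `P` of the complement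
`M = {¼ ≤ g'}` of a third tube (`jA` is injective). [folklore] -/
theorem disjoint_image_jA_preimage_incl (hreg' : IsRegularLevel (𝓡 (k + 1)) g' (1 / 4))
    {φ : (RegularSublevel.boundaryData hreg'.const_sub).carrier ≃ bN.carrier}
    (G : BoundaryGluingData (RegularSublevel.boundaryData hreg'.const_sub) bN φ P)
    {A B : Set Y} (hAB : Disjoint A B) :
    Disjoint (G.jA '' (RegularSublevel.incl hreg'.const_sub ⁻¹' A))
      (G.jA '' (RegularSublevel.incl hreg'.const_sub ⁻¹' B)) := by
  rw [disjoint_iff_forall_ne]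
  rintro _ ⟨a, ha, rfl⟩ _ ⟨b, hb, rfl⟩ h
  have hab : a = b := G.injective_jA h
  subst hab
  exact hAB.ne_of_mem ha hb rfl

end Transport

end Literature.Topology.FourManifolds

end
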